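import Summits.ValiantsHypothesis.ValiantsHypothesis.Theses.SymPencil
import Summits.ValiantsHypothesis.ValiantsHypothesis.Theorems.HubHub

/-!
# ValiantsHypothesis / SymPencil — `Assembly`

Route `SymPencil`, item `stmt-ValiantsHypothesis-5682` (assembly, rank 1):
`SdcOfDc → SdcThesis → (VP families have qp-bounded dc) → (renaming bridge for the permanent
family) → per ∈ VNP → ValiantsHypothesis`.

Bookkeeping. Suppose `VP ℂ = VNP ℂ`. By the hub lemma
(`Summit.ValiantsHypothesis.Hub.valiantsHypothesis_of_not_isVPFamily_per`) it suffices to refute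
`IsVPFamily (fun n => perPoly (Fin n) ℂ)`. If the permanent were a `VP` family, the third
hypothesis gives `c` with `dc(per_n) ≤ 2 ^ ((log₂ n + c) ^ c)` for all `n`; the infimum `dc` is
attained (`hasDetRepr_determinantalComplexity_holds`, Valiant universality), and `SdcOfDc`
(GKKP 2011, Thm. 5) turns that representation into a SYMMETRIC one of size
`m' ≤ 4·dc(per_n)³ + 7 ≤ 16 · 2 ^ (3 (log₂ n + c) ^ c) = 2 ^ (3 (log₂ n + c) ^ c + 4)
≤ 2 ^ ((log₂ n + c + 4) ^ (c + 4))`, so `c' = c + 4` witnesses the quasi-polynomial bound that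
`SdcThesis` forbids. The only arithmetic is the exponent estimate
`3 t ^ c + 4 ≤ (t + 4) ^ (c + 4)` (`t = log₂ n + c`), from `(t+4)^(c+4) = (t+4)^c · (t+4)^4`,
`(t+4)^c ≥ max (t^c) 1` and `(t+4)^4 ≥ 7`.
-/

-- `Summit.ValiantsHypothesis.ValiantsHypothesis.…` is the tree's mandated single-conjunct layout
-- (Sub = Summit), so the duplicated namespace component is intended.
set_option linter.dupNamespace false

namespace Summit.ValiantsHypothesis.ValiantsHypothesis.Theorems.SymPencil

open Literature.Computability.AlgebraicComplexity

/-- Exponent bookkeeping for the assembly: `3 · t ^ c + 4 ≤ (t + 4) ^ (c + 4)` for all naturals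
`t, c` (write `(t+4)^(c+4) = (t+4)^c · (t+4)^4`, use `t^c ≤ (t+4)^c`, `1 ≤ (t+4)^c` and
`7 ≤ 4^4 ≤ (t+4)^4`). [folklore] -/
theorem assembly_exponent_le (t c : ℕ) :
    3 * t ^ c + 4 ≤ (t + 4) ^ (c + 4) := by
  have h1 : t ^ c ≤ (t + 4) ^ c := Nat.pow_le_pow_left (Nat.le_add_right t 4) c
  have h2 : 1 ≤ (t + 4) ^ c := Nat.one_le_pow c (t + 4) (Nat.succ_pos _)
  have h3 : 4 ^ 4 ≤ (t + 4) ^ 4 := Nat.pow_le_pow_left (Nat.le_add_left 4 t) 4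
  have h4 : 7 * (t + 4) ^ c ≤ (t + 4) ^ 4 * (t + 4) ^ c :=
    Nat.mul_le_mul_right _ (le_trans (by norm_num) h3)
  calc 3 * t ^ c + 4 ≤ 3 * (t + 4) ^ c + 4 * (t + 4) ^ c := by omega
    _ = 7 * (t + 4) ^ c := by ring
    _ ≤ (t + 4) ^ 4 * (t + 4) ^ c := h4
    _ = (t + 4) ^ (c + 4) := by ring

/-- Size bookkeeping for the assembly: if `d ≤ 2 ^ e` then `4 d³ + 7 ≤ 2 ^ (3 e + 4)`
(`4 d³ + 7 ≤ 11 (2^e)³ ≤ 16 (2^e)³ = 2^(3e+4)`). [folklore] -/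
theorem assembly_size_le {d e : ℕ} (hd : d ≤ 2 ^ e) :
    4 * d ^ 3 + 7 ≤ 2 ^ (3 * e + 4) := by
  have h1 : d ^ 3 ≤ (2 ^ e) ^ 3 := Nat.pow_le_pow_left hd 3
  have h2 : 1 ≤ (2 ^ e) ^ 3 := Nat.one_le_pow _ _ (by positivity)
  calc 4 * d ^ 3 + 7 ≤ 4 * (2 ^ e) ^ 3 + 7 * (2 ^ e) ^ 3 := by omega
    _ ≤ 16 * (2 ^ e) ^ 3 := by omega
    _ = 2 ^ (3 * e + 4) := by ring

/-- Settles `stmt-ValiantsHypothesis-5682` (`Assembly`, route `SymPencil`):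
`SdcOfDc → SdcThesis → (VP families have qp-bounded dc) → (perFamily ℂ ∈ VP ℂ ↔ IsVPFamily per)
→ perFamily ℂ ∈ VNP ℂ → ValiantsHypothesis`. Were `VP ℂ = VNP ℂ`, the permanent would be a `VP`
family (bridge + `per ∈ VNP`, packaged in the hub lemma
`Summit.ValiantsHypothesis.Hub.valiantsHypothesis_of_not_isVPFamily_per`), hence
`dc(per_n) ≤ 2^((log₂ n + c)^c)`; the attained representation
(`hasDetRepr_determinantalComplexity_holds`) is symmetrised by `SdcOfDc` to size
`≤ 4 dc³ + 7 ≤ 2^((log₂ n + c + 4)^(c + 4))` (`assembly_size_le`,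
`assembly_exponent_le`), contradicting `SdcThesis` with the constant `c + 4`.
[folklore] -/
theorem assembly_proof :
    Summit.ValiantsHypothesis.ValiantsHypothesis.Theses.SymPencil.Assembly := by
  unfold Summit.ValiantsHypothesis.ValiantsHypothesis.Theses.SymPencil.Assembly
  intro hSdcOfDc hSdcThesis hQP hbridge hVNP
  refine Summit.ValiantsHypothesis.Hub.valiantsHypothesis_of_not_isVPFamily_per ?_ hbridge hVNP
  intro hVP
  apply hSdcThesis
  obtain ⟨c, hc⟩ := hQP (fun n => perPoly (Fin n) ℂ) hVP
  refine ⟨c + 4, fun n => ?_⟩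
  obtain ⟨m', hm', A, hAsymm, hA⟩ :=
    hSdcOfDc (perPoly (Fin n) ℂ) (determinantalComplexity (perPoly (Fin n) ℂ))
      (hasDetRepr_determinantalComplexity_holds (perPoly (Fin n) ℂ))
  refine ⟨m', ?_, A, hAsymm, hA⟩
  calc m' ≤ 4 * determinantalComplexity (perPoly (Fin n) ℂ) ^ 3 + 7 := hm'
    _ ≤ 2 ^ (3 * (Nat.log 2 n + c) ^ c + 4) := assembly_size_le (hc n)
    _ ≤ 2 ^ ((Nat.log 2 n + (c + 4)) ^ (c + 4)) := by
        refine Nat.pow_le_pow_right (by norm_num) ?_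
        simpa [Nat.add_assoc] using assembly_exponent_le (Nat.log 2 n + c) c

end Summit.ValiantsHypothesis.ValiantsHypothesis.Theorems.SymPencil
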